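import Mathlib.InformationTheory.KullbackLeibler.Basic
import Literature.MathematicalPhysics.KineticTheory.HardSphereEulerProofs
import Literature.Analysis.FluidPDE.HardSphereDynamicsProofs
import Literature.Analysis.FunctionSpaces.TorusCalculusProofs
import Summits.AtomisticToContinuum.HydrodynamicLimit.Theorems.CollisionIsometryCLTMacroClosureStubLedgerScaling
import Summits.AtomisticToContinuum.HydrodynamicLimit.Theorems.CollisionIsometryCLTMacroClosureStubLedgerCalculus
import Summits.AtomisticToContinuum.HydrodynamicLimit.Theorems.CollisionIsometryCLTMacroClosureStubLedgerLogPartitionCore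
import HarnessLib

/-!
# Stub `stub_ledger` of the line `IdeatorTwoSketch` (crux `MacroClosure`), part 5: the log-partition
calculus of smooth local Gibbs families (L2)

Support file (`--supports stmt-AtomisticToContinuum-14870`) for the registered stub
`stub_ledger : LedgerIdentity`; proves conjunct (L2) (`ledger_logPartition`): for `0 < σ < 1/2`,
`t > 0` and a smooth positive one-parameter family `(a, u, θ)` on `[0, t] × 𝕋³`, the log-partition
function `s ↦ log Z(s)`, `Z(s) = canonicalPartition _ (hsDiameter σ N) (N + 1) (localGibbsProfile (a s)
(u s) (θ s))` (the line's `Zpart σ N (a s) (u s) (θ s)`, written unfolded — likewise `Flow σ N` — so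
that this file does not depend on the definitions module), is differentiable within `[0, t]` with
derivative `(N+1) E_{Ψ_s} ⟨emp, ∂ₛ log prof_s⟩` (`∂ₛ` = `derivWithin _ (Icc 0 t)`), continuously
in `s`.

Route: the log-profile is a QUADRATIC VELOCITY POLYNOMIAL with smooth space–time coefficients,
`log prof_s(x, v) = α_s(x) + |v|² β_s(x) + ⟪v, γ_s(x)⟫` with
`α = log a − (3/2) log(2πθ) − |u|²/(2θ)`, `β = −(2θ)⁻¹ ≤ −(2 sup θ)⁻¹ < 0`, `γ = θ⁻¹ u`
(section `QuadFamily`: hypotheses (H1)–(H5) of part 4 for such families, from the uniform bounds of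
part 3); part 4 differentiates `Z(s) = ∫ 𝟙_D ∏ₖ prof_s(zₖ) dz` under the integral sign; finally
`Z'(s)/Z(s) = (N+1) E_{Ψ_s}⟨emp, ∂ₛ log prof_s⟩` because `Ψ_s = Z(s)⁻¹ 𝟙_D ∏ₖ prof_s · dz`
(`localGibbsLaw_eq`, `integral_withDensity_eq_integral_toReal_smul`, `integral_empiricalMeasure`).
-/

noncomputable section

open MeasureTheory Filter Set Topology
open scoped ENNReal ContDiff InnerProductSpace

namespace Summit.AtomisticToContinuum.HydrodynamicLimit.Theorems.MacroClosureLine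

open Literature.MathematicalPhysics.KineticTheory Literature.Analysis.FluidPDE
open Literature.Analysis.FunctionSpaces

namespace StubLedger

/-! ## Quadratic velocity polynomials with smooth space–time coefficients -/

section QuadFamily

variable {S : Set ℝ} {α β : ℝ → T3 → ℝ} {γ : ℝ → T3 → V3}

/-- (Q1) Time derivative of `s ↦ α_s(x) + |v|² β_s(x) + ⟪v, γ_s(x)⟫` within `S`. [folklore] -/
theorem hasDerivWithinAt_quad (hα : Torus.IsSmoothSpaceTimeOn S α)
    (hβ : Torus.IsSmoothSpaceTimeOn S β) (hγ : Torus.IsSmoothSpaceTimeOn S γ) (x : T3) (v : V3)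
    {s : ℝ} (hs : s ∈ S) :
    HasDerivWithinAt (fun s => α s x + ‖v‖ ^ 2 * β s x + ⟪v, γ s x⟫_ℝ)
      (Torus.timeDerivWithin S α s x + ‖v‖ ^ 2 * Torus.timeDerivWithin S β s x +
        ⟪v, Torus.timeDerivWithin S γ s x⟫_ℝ) S s := by
  have h1 := hα.hasDerivWithinAt_slice hs x
  have h2 := (hβ.hasDerivWithinAt_slice hs x).const_mul (‖v‖ ^ 2)
  have h3 := (hasDerivWithinAt_const s S v).inner ℝ (hγ.hasDerivWithinAt_slice hs x)
  simp only [inner_zero_left, add_zero] at h3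
  exact (h1.add h2).add h3

/-- (Q2) Quadratic velocity growth of the time derivative, uniformly on a compact time set of
unique differentiability. [folklore] -/
theorem exists_abs_quad_deriv_le (hSc : IsCompact S) (hU : UniqueDiffOn ℝ S)
    (hα : Torus.IsSmoothSpaceTimeOn S α) (hβ : Torus.IsSmoothSpaceTimeOn S β)
    (hγ : Torus.IsSmoothSpaceTimeOn S γ) :
    ∃ C₁ : ℝ, 0 ≤ C₁ ∧ ∀ s ∈ S, ∀ (x : T3) (v : V3),
      |Torus.timeDerivWithin S α s x + ‖v‖ ^ 2 * Torus.timeDerivWithin S β s x +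
        ⟪v, Torus.timeDerivWithin S γ s x⟫_ℝ| ≤ C₁ * (1 + ‖v‖ ^ 2) := by
  obtain ⟨A, hA, hA'⟩ := exists_forall_norm_timeDerivWithin_le hSc hU hα
  obtain ⟨B, hB, hB'⟩ := exists_forall_norm_timeDerivWithin_le hSc hU hβ
  obtain ⟨G, hG, hG'⟩ := exists_forall_norm_timeDerivWithin_le hSc hU hγ
  refine ⟨A + B + G, by positivity, fun s hs x v => ?_⟩
  have ha : |Torus.timeDerivWithin S α s x| ≤ A := by simpa [Real.norm_eq_abs] using hA' s hs x
  have hb : |Torus.timeDerivWithin S β s x| ≤ B := by simpa [Real.norm_eq_abs] using hB' s hs x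
  have hg : ‖Torus.timeDerivWithin S γ s x‖ ≤ G := hG' s hs x
  have hin : |⟪v, Torus.timeDerivWithin S γ s x⟫_ℝ| ≤ ‖v‖ * G :=
    (abs_real_inner_le_norm _ _).trans (mul_le_mul_of_nonneg_left hg (norm_nonneg _))
  have hv : ‖v‖ ≤ 1 + ‖v‖ ^ 2 := by nlinarith [norm_nonneg v, sq_nonneg (‖v‖ - 1)]
  have hb2 : |‖v‖ ^ 2 * Torus.timeDerivWithin S β s x| ≤ ‖v‖ ^ 2 * B := by
    rw [abs_mul, abs_of_nonneg (sq_nonneg _)]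
    exact mul_le_mul_of_nonneg_left hb (sq_nonneg _)
  calc _ ≤ |Torus.timeDerivWithin S α s x| + |‖v‖ ^ 2 * Torus.timeDerivWithin S β s x| +
          |⟪v, Torus.timeDerivWithin S γ s x⟫_ℝ| := abs_add_three _ _ _
    _ ≤ A + ‖v‖ ^ 2 * B + ‖v‖ * G := add_le_add (add_le_add ha hb2) hin
    _ ≤ (A + B + G) * (1 + ‖v‖ ^ 2) := by
        nlinarith [mul_le_mul_of_nonneg_right hv hG.le, sq_nonneg ‖v‖, mul_nonneg hA.le (sq_nonneg ‖v‖)]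

/-- (Q3) Gaussian domination: if `β ≤ −b₀ < 0` on `S`, then
`α_s(x) + |v|² β_s(x) + ⟪v, γ_s(x)⟫ ≤ C₂ − (b₀/2)|v|²` uniformly on a compact `S`. [folklore] -/
theorem exists_quad_le (hSc : IsCompact S) (hα : Torus.IsSmoothSpaceTimeOn S α)
    (hγ : Torus.IsSmoothSpaceTimeOn S γ) {b₀ : ℝ} (hb₀ : 0 < b₀)
    (hβle : ∀ s ∈ S, ∀ x, β s x ≤ -b₀) :
    ∃ C₂ : ℝ, ∀ s ∈ S, ∀ (x : T3) (v : V3),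
      α s x + ‖v‖ ^ 2 * β s x + ⟪v, γ s x⟫_ℝ ≤ C₂ - b₀ / 2 * ‖v‖ ^ 2 := by
  obtain ⟨A, hA, hA'⟩ := exists_forall_norm_le_of_isSmoothSpaceTimeOn hSc hα
  obtain ⟨G, hG, hG'⟩ := exists_forall_norm_le_of_isSmoothSpaceTimeOn hSc hγ
  refine ⟨A + G ^ 2 / (2 * b₀), fun s hs x v => ?_⟩
  have ha : α s x ≤ A := (le_abs_self _).trans (by simpa [Real.norm_eq_abs] using hA' s hs x)
  have hg : ‖γ s x‖ ≤ G := hG' s hs x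
  have hin : ⟪v, γ s x⟫_ℝ ≤ ‖v‖ * G :=
    (real_inner_le_norm _ _).trans (mul_le_mul_of_nonneg_left hg (norm_nonneg _))
  have hβ' : ‖v‖ ^ 2 * β s x ≤ ‖v‖ ^ 2 * (-b₀) :=
    mul_le_mul_of_nonneg_left (hβle s hs x) (sq_nonneg _)
  have key : ‖v‖ * G ≤ b₀ / 2 * ‖v‖ ^ 2 + G ^ 2 / (2 * b₀) := by
    have h2 : 2 * b₀ * (b₀ / 2 * ‖v‖ ^ 2 + G ^ 2 / (2 * b₀)) = b₀ ^ 2 * ‖v‖ ^ 2 + G ^ 2 := by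
      field_simp
    have h1 : 2 * b₀ * (‖v‖ * G) ≤ 2 * b₀ * (b₀ / 2 * ‖v‖ ^ 2 + G ^ 2 / (2 * b₀)) := by
      rw [h2]; nlinarith [sq_nonneg (b₀ * ‖v‖ - G)]
    exact le_of_mul_le_mul_left h1 (by positivity)
  linarith

/-- (Q4a) The polynomial is continuous in `(x, v)` for `s ∈ S`. [folklore] -/
theorem continuous_quad (hα : Torus.IsSmoothSpaceTimeOn S α) (hβ : Torus.IsSmoothSpaceTimeOn S β)
    (hγ : Torus.IsSmoothSpaceTimeOn S γ) {s : ℝ} (hs : s ∈ S) :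
    Continuous fun y : T3 × V3 => α s y.1 + ‖y.2‖ ^ 2 * β s y.1 + ⟪y.2, γ s y.1⟫_ℝ :=
  (((hα.isSmooth_slice hs).continuous.comp continuous_fst).add
    ((continuous_snd.norm.pow 2).mul ((hβ.isSmooth_slice hs).continuous.comp continuous_fst))).add
    (continuous_snd.inner ((hγ.isSmooth_slice hs).continuous.comp continuous_fst))

/-- (Q4b) The time derivative of the polynomial is continuous in `(x, v)` for `s ∈ S`. [folklore] -/
theorem continuous_quad_deriv (hU : UniqueDiffOn ℝ S) (hα : Torus.IsSmoothSpaceTimeOn S α)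
    (hβ : Torus.IsSmoothSpaceTimeOn S β) (hγ : Torus.IsSmoothSpaceTimeOn S γ) {s : ℝ} (hs : s ∈ S) :
    Continuous fun y : T3 × V3 => Torus.timeDerivWithin S α s y.1 +
      ‖y.2‖ ^ 2 * Torus.timeDerivWithin S β s y.1 + ⟪y.2, Torus.timeDerivWithin S γ s y.1⟫_ℝ :=
  (((hα.isSmooth_timeDerivWithin hU hs).continuous.comp continuous_fst).add
    ((continuous_snd.norm.pow 2).mul
      ((hβ.isSmooth_timeDerivWithin hU hs).continuous.comp continuous_fst))).add
    (continuous_snd.inner ((hγ.isSmooth_timeDerivWithin hU hs).continuous.comp continuous_fst))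

/-- (Q5) The time derivative of the polynomial is continuous in `s` on `S`. [folklore] -/
theorem continuousOn_quad_deriv (hU : UniqueDiffOn ℝ S) (hα : Torus.IsSmoothSpaceTimeOn S α)
    (hβ : Torus.IsSmoothSpaceTimeOn S β) (hγ : Torus.IsSmoothSpaceTimeOn S γ) (y : T3 × V3) :
    ContinuousOn (fun s => Torus.timeDerivWithin S α s y.1 +
      ‖y.2‖ ^ 2 * Torus.timeDerivWithin S β s y.1 + ⟪y.2, Torus.timeDerivWithin S γ s y.1⟫_ℝ) S :=
  ((continuousOn_timeDerivWithin_of_isSmoothSpaceTimeOn hU hα y.1).add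
    (continuousOn_const.mul (continuousOn_timeDerivWithin_of_isSmoothSpaceTimeOn hU hβ y.1))).add
    (continuousOn_const.inner (continuousOn_timeDerivWithin_of_isSmoothSpaceTimeOn hU hγ y.1))

end QuadFamily

/-! ## The local Gibbs log-profile as a quadratic velocity polynomial -/

section Gibbs

variable {S : Set ℝ} {a θ : ℝ → T3 → ℝ} {u : ℝ → T3 → V3}

/-- The log-profile of the local Gibbs family in coordinates, for `s ∈ S`:
`log prof_s(x,v) = [log a + r log(2πθ) − |u|²/(2θ)] + |v|² (−(2θ)⁻¹) + ⟪v, θ⁻¹ u⟫`,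
`r = −3/2`. [folklore] -/
theorem log_localGibbsProfile_eq_quad (ha0 : ∀ s ∈ S, ∀ x, 0 < a s x)
    (hθ0 : ∀ s ∈ S, ∀ x, 0 < θ s x) {s : ℝ} (hs : s ∈ S) (x : T3) (v : V3) :
    Real.log (localGibbsProfile (a s) (u s) (θ s) (x, v)) =
      (Real.log (a s x) + (-(Module.finrank ℝ V3 : ℝ) / 2) * Real.log (2 * Real.pi * θ s x) -
          ‖u s x‖ ^ 2 / (2 * θ s x)) +
        ‖v‖ ^ 2 * (-(2 * θ s x)⁻¹) + ⟪v, (θ s x)⁻¹ • u s x⟫_ℝ := by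
  have hθ := hθ0 s hs x
  rw [log_localGibbsProfile_eq x v (ha0 s hs x) hθ,
    Real.log_rpow (mul_pos (mul_pos two_pos Real.pi_pos) hθ), norm_sub_sq_real,
    real_inner_smul_right]
  field_simp
  ring

/-- The coefficient `α = log a + r log(2πθ) − |u|²/(2θ)` is a smooth space–time field on `S`.
[folklore] -/
theorem isSmoothSpaceTimeOn_gibbsAlpha (ha : Torus.IsSmoothSpaceTimeOn S a)
    (hθ : Torus.IsSmoothSpaceTimeOn S θ) (hu : Torus.IsSmoothSpaceTimeOn S u)
    (ha0 : ∀ s ∈ S, ∀ x, 0 < a s x) (hθ0 : ∀ s ∈ S, ∀ x, 0 < θ s x) :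
    Torus.IsSmoothSpaceTimeOn S fun s x => Real.log (a s x) +
      (-(Module.finrank ℝ V3 : ℝ) / 2) * Real.log (2 * Real.pi * θ s x) - ‖u s x‖ ^ 2 / (2 * θ s x) := by
  unfold Torus.IsSmoothSpaceTimeOn at *
  have ha' : ∀ p ∈ S ×ˢ (univ : Set (EuclideanSpace ℝ (Fin 3))), Torus.stLift a p ≠ 0 :=
    fun p hp => (ha0 p.1 hp.1 _).ne'
  have hθ' : ∀ p ∈ S ×ˢ (univ : Set (EuclideanSpace ℝ (Fin 3))), 2 * Torus.stLift θ p ≠ 0 :=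
    fun p hp => (mul_pos two_pos (hθ0 p.1 hp.1 _)).ne'
  have h2πθ' : ∀ p ∈ S ×ˢ (univ : Set (EuclideanSpace ℝ (Fin 3))),
      2 * Real.pi * Torus.stLift θ p ≠ 0 :=
    fun p hp => (mul_pos (mul_pos two_pos Real.pi_pos) (hθ0 p.1 hp.1 _)).ne'
  exact ((ha.log ha').add (contDiffOn_const.mul ((contDiffOn_const.mul hθ).log h2πθ'))).sub
    ((hu.norm_sq ℝ).div (contDiffOn_const.mul hθ) hθ')

/-- The coefficient `β = −(2θ)⁻¹` is a smooth space–time field on `S`. [folklore] -/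
theorem isSmoothSpaceTimeOn_gibbsBeta (hθ : Torus.IsSmoothSpaceTimeOn S θ)
    (hθ0 : ∀ s ∈ S, ∀ x, 0 < θ s x) :
    Torus.IsSmoothSpaceTimeOn S fun s x => -(2 * θ s x)⁻¹ := by
  unfold Torus.IsSmoothSpaceTimeOn at *
  have hθ' : ∀ p ∈ S ×ˢ (univ : Set (EuclideanSpace ℝ (Fin 3))), 2 * Torus.stLift θ p ≠ 0 :=
    fun p hp => (mul_pos two_pos (hθ0 p.1 hp.1 _)).ne'
  exact ((contDiffOn_const.mul hθ).inv hθ').neg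

/-- The coefficient `γ = θ⁻¹ u` is a smooth space–time field on `S`. [folklore] -/
theorem isSmoothSpaceTimeOn_gibbsGamma (hθ : Torus.IsSmoothSpaceTimeOn S θ)
    (hu : Torus.IsSmoothSpaceTimeOn S u) (hθ0 : ∀ s ∈ S, ∀ x, 0 < θ s x) :
    Torus.IsSmoothSpaceTimeOn S fun s x => (θ s x)⁻¹ • u s x := by
  unfold Torus.IsSmoothSpaceTimeOn at *
  have hθ' : ∀ p ∈ S ×ˢ (univ : Set (EuclideanSpace ℝ (Fin 3))), Torus.stLift θ p ≠ 0 :=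
    fun p hp => (hθ0 p.1 hp.1 _).ne'
  exact (hθ.inv hθ').smul hu

/-- `β = −(2θ)⁻¹ ≤ −(2Θ)⁻¹` on a compact `S`, where `Θ` bounds `θ`. [folklore] -/
theorem exists_gibbsBeta_le (hSc : IsCompact S) (hθ : Torus.IsSmoothSpaceTimeOn S θ)
    (hθ0 : ∀ s ∈ S, ∀ x, 0 < θ s x) :
    ∃ b₀ : ℝ, 0 < b₀ ∧ ∀ s ∈ S, ∀ x, -(2 * θ s x)⁻¹ ≤ -b₀ := by
  obtain ⟨Θ, hΘ, hΘ'⟩ := exists_forall_norm_le_of_isSmoothSpaceTimeOn hSc hθ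
  refine ⟨(2 * Θ)⁻¹, by positivity, fun s hs x => neg_le_neg (inv_two_mul_ge (hθ0 s hs x) ?_)⟩
  exact (le_abs_self _).trans (by simpa [Real.norm_eq_abs] using hΘ' s hs x)

end Gibbs

/-! ## (L2) The log-partition calculus -/

/-- Gibbs expectation of an empirical average: for `s` with `prof_s > 0` and `Z_s > 0`,
`E_{Ψ_s}[(N+1)⁻¹ ∑ₖ g(zₖ)] = Z_s⁻¹ (N+1)⁻¹ ∫ 𝟙_D ∏ₖ prof_s(zₖ) ∑ₖ g(zₖ) dz`
(`localGibbsLaw_eq`: the law is `Z⁻¹ 𝟙_D ∏ₖ prof · dz`). [folklore] -/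
theorem integral_localGibbsLaw_avg {σ : ℝ} {N : ℕ}
    (Φ : HardSphereFlow (Torus.geometry (Fin 3)) (hsDiameter σ N) (N + 1)) {a₀ θ₀ : T3 → ℝ}
    {u₀ : T3 → V3}
    (ha : Continuous a₀) (hθ : Continuous θ₀) (hu : Continuous u₀) (ha0 : ∀ x, 0 < a₀ x)
    (hθ0 : ∀ x, 0 < θ₀ x) (g : T3 × V3 → ℝ) :
    ∫ z, ((N : ℝ) + 1)⁻¹ * ∑ k, g (z k) ∂(localGibbsLaw σ a₀ u₀ θ₀ N Φ) =
      (canonicalPartition (Torus.geometry (Fin 3)) (hsDiameter σ N) (N + 1)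
          (localGibbsProfile a₀ u₀ θ₀))⁻¹ * ((N : ℝ) + 1)⁻¹ *
        ∫ z, (hardSphereDomain (Torus.geometry (Fin 3)) (N + 1) (hsDiameter σ N)).indicator
          (fun z => Real.exp (∑ k, Real.log (localGibbsProfile a₀ u₀ θ₀ (z k))) *
            ∑ k, g (z k)) z := by
  rw [localGibbsLaw_eq, localGibbsMeasure, integral_withDensity_eq_integral_toReal_smul
    ((measurable_canonicalDensity _ _ (measurable_localGibbsProfile ha hθ hu)).ennreal_ofReal)
    (ae_of_all _ fun _ => ENNReal.ofReal_lt_top), ← integral_const_mul]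
  refine integral_congr_ae (ae_of_all _ fun z => ?_)
  have hcd : 0 ≤ canonicalDensity (Torus.geometry (Fin 3)) (hsDiameter σ N) (N + 1)
      (localGibbsProfile a₀ u₀ θ₀) z :=
    mul_nonneg (inv_nonneg.2 (canonicalPartition_nonneg _ _ _
      (fun y => localGibbsProfile_nonneg (fun x => (ha0 x).le) (fun x => (hθ0 x).le) y)))
      (Set.indicator_nonneg (fun w _ => tensorPow_nonneg
        (fun y => localGibbsProfile_nonneg (fun x => (ha0 x).le) (fun x => (hθ0 x).le) y) _ w) _)
  have hF : (fun z : Config (N + 1) (Fin 3) T3 =>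
      Real.exp (∑ k, Real.log (localGibbsProfile a₀ u₀ θ₀ (z k)))) =
      tensorPow (N + 1) (localGibbsProfile a₀ u₀ θ₀) := by
    funext z
    rw [tensorPow, Real.exp_sum]
    exact Finset.prod_congr rfl fun k _ => Real.exp_log (localGibbsProfile_pos ha0 hθ0 _)
  dsimp only
  rw [ENNReal.toReal_ofReal hcd, smul_eq_mul, Set.indicator_mul_left, hF, canonicalDensity]
  ring

/-- (L2), measure-theoretic assembly: given ANY time derivative `ψ'` of the log-profile within
`S = [0, t]` with the hypotheses (H1)–(H5) of part 4, the log-partition function has derivative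
`(N+1) E_{Ψ_s}⟨emp, ∂ₛ log prof_s⟩` within `S`, continuously in `s`. [folklore] -/
theorem ledger_logPartition_of_deriv {σ : ℝ} (hσ2 : σ < 2⁻¹) {N : ℕ}
    (Φ : HardSphereFlow (Torus.geometry (Fin 3)) (hsDiameter σ N) (N + 1)) {t : ℝ}
    (ht : 0 < t) {a θ : ℝ → T3 → ℝ} {u : ℝ → T3 → V3}
    (hac : ∀ s ∈ Icc 0 t, Continuous (a s)) (hθc : ∀ s ∈ Icc 0 t, Continuous (θ s))
    (huc : ∀ s ∈ Icc 0 t, Continuous (u s)) (ha0 : ∀ s ∈ Icc 0 t, ∀ x, 0 < a s x)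
    (hθ0 : ∀ s ∈ Icc 0 t, ∀ x, 0 < θ s x) {ψ' : ℝ → T3 × V3 → ℝ} {C₁ C₂ b : ℝ} (hC₁ : 0 ≤ C₁)
    (hb : 0 < b)
    (H1 : ∀ y, ∀ s ∈ Icc 0 t, HasDerivWithinAt
      (fun s => Real.log (localGibbsProfile (a s) (u s) (θ s) y)) (ψ' s y) (Icc 0 t) s)
    (H2 : ∀ s ∈ Icc 0 t, ∀ y, |ψ' s y| ≤ C₁ * (1 + ‖y.2‖ ^ 2))
    (H3 : ∀ s ∈ Icc 0 t, ∀ y, Real.log (localGibbsProfile (a s) (u s) (θ s) y) ≤ C₂ - b * ‖y.2‖ ^ 2)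
    (H4 : ∀ s ∈ Icc 0 t, Measurable (ψ' s)) (H5 : ∀ y, ContinuousOn (fun s => ψ' s y) (Icc 0 t)) :
    (∀ s ∈ Icc 0 t, HasDerivWithinAt (fun s' => Real.log (canonicalPartition (Torus.geometry (Fin 3)) (hsDiameter σ N) (N + 1)
          (localGibbsProfile (a s') (u s') (θ s'))))
      (((N : ℝ) + 1) * ∫ z, (∫ y, derivWithin
        (fun s' => Real.log (localGibbsProfile (a s') (u s') (θ s') y)) (Icc 0 t) s
          ∂(empiricalMeasure z)) ∂(localGibbsLaw σ (a s) (u s) (θ s) N Φ)) (Icc 0 t) s) ∧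
    ContinuousOn (fun s => ∫ z, (∫ y, derivWithin
        (fun s' => Real.log (localGibbsProfile (a s') (u s') (θ s') y)) (Icc 0 t) s
          ∂(empiricalMeasure z)) ∂(localGibbsLaw σ (a s) (u s) (θ s) N Φ)) (Icc 0 t) := by
  have hU : UniqueDiffOn ℝ (Icc 0 t) := uniqueDiffOn_Icc ht
  have hσ2' : σ ≤ 1 / 2 := by rw [one_div]; exact hσ2.le
  have H0 : ∀ s ∈ Icc 0 t, Measurable fun y => Real.log (localGibbsProfile (a s) (u s) (θ s) y) :=
    fun s hs => Real.measurable_log.comp (measurable_localGibbsProfile (hac s hs) (hθc s hs) (huc s hs))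
  have hD : MeasurableSet (hardSphereDomain (Torus.geometry (Fin 3)) (N + 1) (hsDiameter σ N)) :=
    measurableSet_hardSphereDomain _ Torus.measurable_geometry_sepVec _ _
  -- the partition function as the integral of the weight
  have hZ : ∀ s ∈ Icc 0 t, canonicalPartition (Torus.geometry (Fin 3)) (hsDiameter σ N) (N + 1)
        (localGibbsProfile (a s) (u s) (θ s)) =
      ∫ z, (hardSphereDomain (Torus.geometry (Fin 3)) (N + 1) (hsDiameter σ N)).indicator
        (fun z => Real.exp (∑ k, Real.log (localGibbsProfile (a s) (u s) (θ s) (z k)))) z := by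
    intro s hs
    have hF : (fun z : Config (N + 1) (Fin 3) T3 =>
        Real.exp (∑ k, Real.log (localGibbsProfile (a s) (u s) (θ s) (z k)))) =
        tensorPow (N + 1) (localGibbsProfile (a s) (u s) (θ s)) := by
      funext z
      rw [tensorPow, Real.exp_sum]
      exact Finset.prod_congr rfl fun k _ =>
        Real.exp_log (localGibbsProfile_pos (ha0 s hs) (hθ0 s hs) _)
    rw [hF]
    rfl
  have hZpos : ∀ s ∈ Icc 0 t, 0 < canonicalPartition (Torus.geometry (Fin 3)) (hsDiameter σ N) (N + 1)
        (localGibbsProfile (a s) (u s) (θ s)) := fun s hs =>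
    canonicalPartition_localGibbs_pos hσ2' N (hac s hs) (hθc s hs) (huc s hs) (ha0 s hs) (hθ0 s hs)
  -- differentiation under the integral sign (part 4)
  have hderiv : ∀ s ∈ Icc 0 t, HasDerivWithinAt (fun s => canonicalPartition (Torus.geometry (Fin 3)) (hsDiameter σ N) (N + 1)
        (localGibbsProfile (a s) (u s) (θ s)))
      (∫ z, (hardSphereDomain (Torus.geometry (Fin 3)) (N + 1) (hsDiameter σ N)).indicator
        (fun z => Real.exp (∑ k, Real.log (localGibbsProfile (a s) (u s) (θ s) (z k))) *
          ∑ k, ψ' s (z k)) z) (Icc 0 t) s :=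
    fun s hs => (hasDerivWithinAt_integral_indicator_exp_sum hD (convex_Icc 0 t) hC₁ hb H1 H2 H3
      H0 H4 hs).congr_of_mem (fun s' hs' => hZ s' hs') hs
  -- (no expected type here: the one-particle log-density is inferred from `H1` by pattern
  -- unification, not from the integrand)
  have hcontZ' := continuousOn_integral_indicator_exp_sum_mul hD hC₁ hb H1 H2 H3 H0 H4 H5
  -- the Gibbs expectation of the empirical score
  have hexp : ∀ s ∈ Icc 0 t, ∫ z, (∫ y, derivWithin
      (fun s' => Real.log (localGibbsProfile (a s') (u s') (θ s') y)) (Icc 0 t) s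
        ∂(empiricalMeasure z)) ∂(localGibbsLaw σ (a s) (u s) (θ s) N Φ) =
      (canonicalPartition (Torus.geometry (Fin 3)) (hsDiameter σ N) (N + 1)
            (localGibbsProfile (a s) (u s) (θ s)))⁻¹ * ((N : ℝ) + 1)⁻¹ * ∫ z,
        (hardSphereDomain (Torus.geometry (Fin 3)) (N + 1) (hsDiameter σ N)).indicator (fun z =>
          Real.exp (∑ k, Real.log (localGibbsProfile (a s) (u s) (θ s) (z k))) *
            ∑ k, ψ' s (z k)) z := by
    intro s hs
    have hdlog : ∀ z : Config (N + 1) (Fin 3) T3, ∫ y, derivWithin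
        (fun s' => Real.log (localGibbsProfile (a s') (u s') (θ s') y)) (Icc 0 t) s
          ∂(empiricalMeasure z) = ((N : ℝ) + 1)⁻¹ * ∑ k, ψ' s (z k) := by
      intro z
      rw [integral_empiricalMeasure]
      push_cast
      congr 1
      exact Finset.sum_congr rfl fun k _ => (H1 (z k) s hs).derivWithin (hU s hs)
    simp_rw [hdlog]
    exact integral_localGibbsLaw_avg Φ (hac s hs) (hθc s hs) (huc s hs) (ha0 s hs) (hθ0 s hs) (ψ' s)
  refine ⟨fun s hs => ((hderiv s hs).log (hZpos s hs).ne').congr_deriv ?_, ?_⟩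
  · rw [hexp s hs]
    have hZ0 : canonicalPartition (Torus.geometry (Fin 3)) (hsDiameter σ N) (N + 1)
          (localGibbsProfile (a s) (u s) (θ s)) ≠ 0 := (hZpos s hs).ne'
    field_simp
  · have hcontZ : ContinuousOn (fun s => canonicalPartition (Torus.geometry (Fin 3)) (hsDiameter σ N) (N + 1)
        (localGibbsProfile (a s) (u s) (θ s))) (Icc 0 t) :=
      fun s hs => (hderiv s hs).continuousWithinAt
    have hg : ContinuousOn (fun s => (canonicalPartition (Torus.geometry (Fin 3)) (hsDiameter σ N) (N + 1)
          (localGibbsProfile (a s) (u s) (θ s)))⁻¹ * ((N : ℝ) + 1)⁻¹ * ∫ z,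
        (hardSphereDomain (Torus.geometry (Fin 3)) (N + 1) (hsDiameter σ N)).indicator (fun z =>
          Real.exp (∑ k, Real.log (localGibbsProfile (a s) (u s) (θ s) (z k))) *
            ∑ k, ψ' s (z k)) z) (Icc 0 t) :=
      ((hcontZ.inv₀ fun s hs => (hZpos s hs).ne').mul continuousOn_const).mul hcontZ'
    exact hg.congr fun s hs => hexp s hs

/-- **(L2)** The log-partition function of a smooth positive one-parameter family of local Gibbs
profiles on `[0, t]` (`t > 0`, `σ < 1/2`) is differentiable within `[0, t]` with derivative
`(N+1) E_{Ψ_s}⟨emp, ∂ₛ log prof_s⟩`, and the latter expectation is continuous on `[0, t]`.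
[folklore] -/
theorem ledger_logPartition {σ : ℝ} (hσ2 : σ < 2⁻¹) {N : ℕ}
    (Φ : HardSphereFlow (Torus.geometry (Fin 3)) (hsDiameter σ N) (N + 1)) {t : ℝ} (ht : 0 < t)
    {a θ : ℝ → T3 → ℝ} {u : ℝ → T3 → V3}
    (ha : Torus.IsSmoothSpaceTimeOn (Icc 0 t) a) (hθ : Torus.IsSmoothSpaceTimeOn (Icc 0 t) θ)
    (hu : Torus.IsSmoothSpaceTimeOn (Icc 0 t) u) (ha0 : ∀ s ∈ Icc 0 t, ∀ x, 0 < a s x)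
    (hθ0 : ∀ s ∈ Icc 0 t, ∀ x, 0 < θ s x) :
    (∀ s ∈ Icc 0 t, HasDerivWithinAt (fun s' => Real.log (canonicalPartition (Torus.geometry (Fin 3)) (hsDiameter σ N) (N + 1)
          (localGibbsProfile (a s') (u s') (θ s'))))
      (((N : ℝ) + 1) * ∫ z, (∫ y, derivWithin
        (fun s' => Real.log (localGibbsProfile (a s') (u s') (θ s') y)) (Icc 0 t) s
          ∂(empiricalMeasure z)) ∂(localGibbsLaw σ (a s) (u s) (θ s) N Φ)) (Icc 0 t) s) ∧
    ContinuousOn (fun s => ∫ z, (∫ y, derivWithin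
        (fun s' => Real.log (localGibbsProfile (a s') (u s') (θ s') y)) (Icc 0 t) s
          ∂(empiricalMeasure z)) ∂(localGibbsLaw σ (a s) (u s) (θ s) N Φ)) (Icc 0 t) := by
  have hSc : IsCompact (Icc (0 : ℝ) t) := isCompact_Icc
  have hU : UniqueDiffOn ℝ (Icc (0 : ℝ) t) := uniqueDiffOn_Icc ht
  -- the smooth coefficient fields of the quadratic velocity polynomial `log prof`
  have hα := isSmoothSpaceTimeOn_gibbsAlpha ha hθ hu ha0 hθ0
  have hβ := isSmoothSpaceTimeOn_gibbsBeta hθ hθ0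
  have hγ := isSmoothSpaceTimeOn_gibbsGamma hθ hu hθ0
  obtain ⟨C₁, hC₁, H2⟩ := exists_abs_quad_deriv_le hSc hU hα hβ hγ
  obtain ⟨b₀, hb₀, hβle⟩ := exists_gibbsBeta_le hSc hθ hθ0
  obtain ⟨C₂, H3⟩ := exists_quad_le hSc hα hγ hb₀ hβle
  refine ledger_logPartition_of_deriv (C₂ := C₂) hσ2 Φ ht (fun s hs => (ha.isSmooth_slice hs).continuous)
    (fun s hs => (hθ.isSmooth_slice hs).continuous) (fun s hs => (hu.isSmooth_slice hs).continuous)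
    ha0 hθ0 hC₁ (half_pos hb₀) (fun y s hs => ?_) (fun s hs y => H2 s hs y.1 y.2) (fun s hs y => ?_)
    (fun s hs => (continuous_quad_deriv hU hα hβ hγ hs).measurable)
    (fun y => continuousOn_quad_deriv hU hα hβ hγ y)
  · exact (hasDerivWithinAt_quad hα hβ hγ y.1 y.2 hs).congr_of_mem
      (fun s' hs' => log_localGibbsProfile_eq_quad ha0 hθ0 hs' y.1 y.2) hs
  · rw [log_localGibbsProfile_eq_quad ha0 hθ0 hs y.1 y.2]
    exact H3 s hs y.1 y.2

end StubLedger

/-- Registered sub-goal `stub_ledger_logPartition` of the stub `stub_ledger`: conjunct (L2), the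
log-partition calculus of smooth local Gibbs families (`StubLedger.ledger_logPartition`).
[folklore] -/
theorem stub_ledger_logPartition : ∀ σ : ℝ, 0 < σ → σ < 2⁻¹ → ∀ (N : ℕ) (Φ : HardSphereFlow (Torus.geometry (Fin 3)) (hsDiameter σ N) (N + 1)) (t : ℝ), 0 < t → ∀ (a θ : ℝ → T3 → ℝ) (u : ℝ → T3 → V3), Torus.IsSmoothSpaceTimeOn (Icc 0 t) a → Torus.IsSmoothSpaceTimeOn (Icc 0 t) θ → Torus.IsSmoothSpaceTimeOn (Icc 0 t) u → (∀ s ∈ Icc 0 t, ∀ x, 0 < a s x) → (∀ s ∈ Icc 0 t, ∀ x, 0 < θ s x) → (∀ s ∈ Icc 0 t, HasDerivWithinAt (fun s' => Real.log (canonicalPartition (Torus.geometry (Fin 3)) (hsDiameter σ N) (N + 1) (localGibbsProfile (a s') (u s') (θ s')))) (((N : ℝ) + 1) * ∫ z, (∫ y, derivWithin (fun s' => Real.log (localGibbsProfile (a s') (u s') (θ s') y)) (Icc 0 t) s ∂(empiricalMeasure z)) ∂(localGibbsLaw σ (a s) (u s) (θ s) N Φ)) (Icc 0 t) s) ∧ ContinuousOn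 (fun s => ∫ z, (∫ y, derivWithin (fun s' => Real.log (localGibbsProfile (a s') (u s') (θ s') y)) (Icc 0 t) s ∂(empiricalMeasure z)) ∂(localGibbsLaw σ (a s) (u s) (θ s) N Φ)) (Icc 0 t) :=
  fun _ _ hσ2 _ Φ _ ht _ _ _ ha hθ hu ha0 hθ0 => StubLedger.ledger_logPartition hσ2 Φ ht ha hθ hu ha0 hθ0

end Summit.AtomisticToContinuum.HydrodynamicLimit.Theorems.MacroClosureLine

end
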